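import Summits.BirchSwinnertonDyer.BirchSwinnertonDyer.Theorems.PrintCf2RamifiedOffTYZLevelTwoTwoPrimes
import HarnessLib

/-!
# Crux `PrintCf2.RamifiedOffTYZOfFacts` (stmt-BirchSwinnertonDyer-20509), line `offtyz-v7`, LEAD cycle 11 (cruxlead-20509 g10), part 2:
# THE EVEN TWO-PRIME SECTOR OF C⁺ — `n = 2lq`, types E1 `(l, q) ≡ (1, 3)` and E2 `(l, q) ≡ (1, 7) (mod 8)`, `(q/l) = +1`

THEOREMS ONLY (no `def`, no named fact, no `sorry`), `--supports stmt-BirchSwinnertonDyer-20509` (stub 7 = C⁺ = item 23431).  Sequel of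
`…LevelTwoTwoPrimes` (p720648: the ODD two-prime sector, types R1/R2), same HONEST FRAMING: bookkeeping on Tian–Yuan–Zhang 2017 §3 AS DISPLAYED
(`GenusPointData.recursion`, `epsSpec`, `thm35Main`, `scriptLSpec`), GZK by name inside g3's depth criterion, and display-shaped hypotheses =
Thm 3.5's main clause for the proper divisors `d₀ ∈ recursionIndex n` read inside `ℍ′_n` (`2·P(d₀) ≡ u·𝓛(d₀)·α_{d₀}` mod torsion).
Nothing is asserted; C⁺ stays open; BSD is not proved by any of this.

THE SECTOR (Monsky's even matrix [cite: HeathBrown1994SelmerCongruentII, Appendix (Monsky), typescript p. 41 L20–L36], exhaustive over residue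
types, LEAD instrument `instruments/k2_types.py`): the even two-prime members of the jump-one class are `n = 2lq`, `l ≡ 1 (mod 8)`, `(q/l) = +1`,
`q ≡ 3` (E1) or `q ≡ 7 (mod 8)` (E2).
* E1 (§2): `recursionIndex (2lq) = {2q}`, `recursionIndex (2q) = ∅` — ONE lower block, the odd sector's shape with `m := 2q`:
  `P(2lq) = Z(2lq) ∓ 𝓛(l)·Z(2q)` EXACT; with `𝓛(l) = 2c′` and Thm 3.5 at `2q`: **`P(2lq) ≡ Z(2lq) − c·α_{2q}` (mod tors)**, `c = ±c′·u·𝓛(2q)`;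
  C⁺(2lq) ⟺ `depth(Z(2lq) − c·α_{2q}) = depth(Q₁)` (`levelTwo_typeE1_iff`); Layer 1 via `twoDivisible_iff_of_even/odd`.
* E2 (§3): `recursionIndex (2lq) = {q, 2q, lq}` — THREE lower blocks, one of which, `lq` (type R2), is ITSELF a two-prime member of the `s = 3`
  class: `P(2lq) = Z(2lq) − s₁𝓛(2l)·P(q) − s₂𝓛(l)·P(2q) − s₃𝓛(2)·P(lq)` EXACT (`P_eq_of_typeE2`); with `𝓛(2l) = 2a′`, `𝓛(l) = 2c′` (Thm 1.1:
  `g(2l)`, `g(l)` even) and Thm 3.5 at `q`, `2q`: **`P(2lq) ≡ Z(2lq) − s₃𝓛(2)·P(lq) − c_q·α_q − c_{2q}·α_{2q}` (mod tors)** — the even member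
  SEES the odd member `lq` with the odd, un-halvable coefficient `𝓛(2)`; through the odd sector's closed form and `𝓛(2) = ±1`:
  `P(2lq) ≡ Z(2lq) ∓ Z(lq) − c₁·α_q − c_{2q}·α_{2q}` (`genusPoint_typeE2_congr_genusPeriods`), and C⁺(2lq) is ONE depth comparison
  (`levelTwo_typeE2_iff`).
Which terms survive on the even two-prime sector: E1 — `Z(2lq)` and, iff `c′·u·𝓛(2q)` is odd, `[α_{2q}]`; E2 — `Z(2lq)`, `Z(lq)` (always), and the
generator classes of `E_q`, `E_{2q}` through the bits `a′ = 𝓛(2l)/2`, `c′ = 𝓛(l)/2` (and `𝓛(2q) mod 2 = 2^{ρ(2q)} mod 2`).  The beyond-print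
objects are `[Z(2lq)]`, `[Z(lq)]` ∈ `A(ℍ′)/(2A + tors)` and their deeper digits, unchanged.

References: [cite: TianYuanZhang2017, §3.1 (p0011 L53–L73), Thm. 3.3, Thm. 3.5 (p0011 L94–L100), Thm. 1.1, Thm. 1.2]; [cite: Darmon2004, Thm. 3.22];
[cite: SilvermanAEC2009, VIII.6]; tree: `…LevelTwoTwoPrimes` (p720648), g3 `…LevelTwoDepth`, bsd-monsky `Rank1Residual/P2/DecompositionsThreePrimes`
(`dvd_mul_three_iff`), `…ThetaRecursion` (`ThetaDescent.recursionIndex_prime`, `dvd_prime_mul_prime_iff`).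
-/

noncomputable section

open scoped Classical

open WeierstrassCurve WeierstrassCurve.Affine Literature.NumberTheory.EllipticCurves
  Literature.NumberTheory.EllipticCurves.TianYuanZhang2017
  Literature.NumberTheory.EllipticCurves.TianYuanZhang2017.W2
  Summit.BirchSwinnertonDyer.Rank1Residual.P2
  Summit.BirchSwinnertonDyer.PrintCf2.LevelTwoHalfGenerator
  Summit.BirchSwinnertonDyer.PrintCf2.LevelTwoDepth
  Summit.BirchSwinnertonDyer.PrintCf2.LevelTwoTwoPrimes

set_option autoImplicit false

namespace Summit.BirchSwinnertonDyer.PrintCf2.LevelTwoTwoPrimesEven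

variable {n : ℕ}

/-! ## §1 One lower block, abstractly: `P(m) = Z(m)`, `P(n) = Z(n) − s·𝓛·Z(m)`, `𝓛 = 2c′`, `2P(m) ≡ uM·α` ⟹ `P(n) ≡ Z(n) − (s c′ u M)·α` -/

/-- **One-block bookkeeping** (the common core of the odd sector and of type E1): from `P(m) = Z(m)`, `P(n) = Z(n) − s·(L·Z(m))`, `L = 2c′` and
`2·P(m) − (u·M)·α` torsion: `P(n) − (Z(n) − (s·c′·u·M)·α)` has finite order. [cite: TianYuanZhang2017, §3.1 (p0011 L67–L73), Thm. 3.5 (p0011 L94–L100)] -/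
theorem genusPoint_congr_of_one_block (D : GenusPointData n) {m : ℕ} {s L c' u M : ℤ} {α : APoint D.H}
    (hPm : D.P m = D.Z m) (hP : D.P n = D.Z n - s • (L • D.Z m)) (hL : L = 2 * c')
    (h35m : IsOfFinAddOrder ((2 : ℤ) • D.P m - (u * M) • α)) :
    IsOfFinAddOrder (D.P n - (D.Z n - (s * c' * (u * M)) • α)) := by
  have e : D.P n - (D.Z n - (s * c' * (u * M)) • α) = (-(s * c')) • ((2 : ℤ) • D.P m - (u * M) • α) := by
    rw [hP, hL, hPm]
    module
  rw [e]
  exact h35m.zsmul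

/-! ## §2 Type E1: `n = 2lq`, `l ≡ 1`, `q ≡ 3 (mod 8)` — one lower block `2q` -/

section TypeE1

/-- `recursionIndex (2q) = ∅` for a prime `q ≡ 3 (mod 8)` (`2q ≡ 6` has cofactor `1`; `q ≡ 3` and `2` are not `≡ 5, 6, 7`).
[cite: TianYuanZhang2017, §3.1 (p0011 L67–L70)] -/
theorem recursionIndex_two_mul_three {q : ℕ} (hq : q.Prime) (hq3 : q % 8 = 3) : recursionIndex (2 * q) = ∅ := by
  ext d₀
  simp only [recursionIndex, Finset.mem_filter, Nat.mem_divisors, Finset.notMem_empty, iff_false, not_and, not_lt]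
  rintro ⟨hd, -⟩ h567 _
  rcases (ThetaDescent.dvd_prime_mul_prime_iff Nat.prime_two hq).mp hd with rfl | rfl | rfl | rfl
  · omega
  · omega
  · omega
  · exact (Nat.div_self (by omega)).le

/-- **`recursionIndex (2lq) = {2q}`** for primes `l ≡ 1`, `q ≡ 3 (mod 8)`: among `1, 2, l, q, 2l, 2q, lq, 2lq` only `d₀ = 2q ≡ 6` has a cofactor
`l ≡ 1 (mod 8)`, `l > 1`. [cite: TianYuanZhang2017, §3.1 (p0011 L67–L70)] -/
theorem recursionIndex_typeE1 {l q : ℕ} (hl : l.Prime) (hq : q.Prime) (hl8 : l % 8 = 1) (hq3 : q % 8 = 3) :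
    recursionIndex (2 * (l * q)) = {2 * q} := by
  have hl2 : l ≠ 2 := by omega
  have hq2 : q ≠ 2 := by omega
  have hN0 : 2 * (l * q) ≠ 0 := Nat.mul_ne_zero two_ne_zero (Nat.mul_ne_zero hl.ne_zero hq.ne_zero)
  have el : 2 * (l * q) / l = 2 * q := by
    rw [show 2 * (l * q) = l * (2 * q) by ring]; exact Nat.mul_div_cancel_left (2 * q) hl.pos
  have eq' : 2 * (l * q) / q = 2 * l := by
    rw [show 2 * (l * q) = q * (2 * l) by ring]; exact Nat.mul_div_cancel_left (2 * l) hq.pos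
  have e2q : 2 * (l * q) / (2 * q) = l := by
    rw [show 2 * (l * q) = (2 * q) * l by ring]; exact Nat.mul_div_cancel_left l (by omega)
  have elq : 2 * (l * q) / (l * q) = 2 := Nat.mul_div_cancel 2 (Nat.mul_pos hl.pos hq.pos)
  have eN : 2 * (l * q) / (2 * (l * q)) = 1 := Nat.div_self (Nat.pos_of_ne_zero hN0)
  have hlq8 : (l * q) % 8 = 3 := by rw [mul_mod_eight_of_one hl8, hq3]
  have h2l8 : (2 * l) % 8 = 2 := by rw [Nat.mul_mod, hl8]
  have h2q8 : (2 * q) % 8 = 6 := by rw [Nat.mul_mod, hq3]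
  ext d₀
  simp only [recursionIndex, Finset.mem_filter, Nat.mem_divisors, Finset.mem_singleton]
  constructor
  · rintro ⟨⟨hd, -⟩, h567, h123, hgt⟩
    have hd' : d₀ ∣ 2 * l * q := by rwa [mul_assoc]
    rcases (dvd_mul_three_iff Nat.prime_two hl hq).mp hd' with rfl | rfl | rfl | rfl | rfl | rfl | rfl | rfl
    · omega
    · omega
    · omega
    · omega
    · omega
    · rfl
    · omega
    · rw [show 2 * l * q = 2 * (l * q) by ring, eN] at hgt; omega
  · rintro rfl
    refine ⟨⟨Dvd.intro_left l (by ring), hN0⟩, by omega, ?_, ?_⟩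
    · rw [e2q]; omega
    · rw [e2q]; exact hl.one_lt

/-- **Type E1 recursion, EXACT**: `P(2q) = Z(2q)` and `P(2lq) = Z(2lq) − s·𝓛(l)·Z(2q)`, `s = ±1` (type `(6, 1) ≠ (5, 3)`).
[cite: TianYuanZhang2017, §3.1 (p0011 L67–L73), Thm. 3.3 (p0011 L49–L51)] -/
theorem P_eq_of_typeE1 {l q : ℕ} (hl : l.Prime) (hq : q.Prime) (hl8 : l % 8 = 1) (hq3 : q % 8 = 3)
    (hn : n = 2 * (l * q)) (D : GenusPointData n) (hrec : D.recursion) (heps : D.epsSpec) :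
    D.P (2 * q) = D.Z (2 * q) ∧ ∃ s : ℤ, (s = 1 ∨ s = -1) ∧ D.P n = D.Z n - s • (D.scriptL l • D.Z (2 * q)) := by
  subst hn
  have hN0 : 2 * (l * q) ≠ 0 := Nat.mul_ne_zero two_ne_zero (Nat.mul_ne_zero hl.ne_zero hq.ne_zero)
  have e2q : 2 * (l * q) / (2 * q) = l := by
    rw [show 2 * (l * q) = (2 * q) * l by ring]; exact Nat.mul_div_cancel_left l (by omega)
  have h2q8 : (2 * q) % 8 = 6 := by rw [Nat.mul_mod, hq3]
  have hn8 : (2 * (l * q)) % 8 = 6 := by rw [Nat.mul_mod, mul_mod_eight_of_one hl8, hq3]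
  have hPm : D.P (2 * q) = D.Z (2 * q) := by
    have h := hrec (2 * q) (Nat.mem_divisors.mpr ⟨Dvd.intro_left l (by ring), hN0⟩) (Or.inr (Or.inl h2q8))
    rw [recursionIndex_two_mul_three hq hq3, Finset.sum_empty, sub_zero] at h
    exact h
  refine ⟨hPm, ?_⟩
  have hP := hrec (2 * (l * q)) (Nat.mem_divisors_self _ hN0) (Or.inr (Or.inl hn8))
  rw [recursionIndex_typeE1 hl hq hl8 hq3, Finset.sum_singleton, e2q, hPm] at hP
  have he : Even (D.eps (2 * q) l) := by
    rw [Nat.even_iff]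
    by_contra hodd
    have h3 : (2 * q) % 8 = 5 ∧ l % 8 = 3 := (heps (2 * q) l).mp (by omega)
    omega
  obtain ⟨s, hs, hsx⟩ := cmIPow_even_eq_sign_smul D he
  exact ⟨s, hs, by rw [hP, hsx]⟩

/-- **Type E1: `P(2lq) ≡ Z(2lq) − c·α_{2q}` modulo torsion**, `c = s·c′·u·𝓛(2q)`, from `𝓛(l) = 2c′` and Thm 3.5 at `2q` read in `ℍ′_{2lq}`
(`h35m : 2·P(2q) − (u·𝓛(2q))·α` torsion). [cite: TianYuanZhang2017, §3.1 (p0011 L67–L73), Thm. 3.5 (p0011 L94–L100), Thm. 1.1] -/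
theorem genusPoint_typeE1_congr {l q : ℕ} (hl : l.Prime) (hq : q.Prime) (hl8 : l % 8 = 1) (hq3 : q % 8 = 3)
    (hn : n = 2 * (l * q)) (D : GenusPointData n) (hrec : D.recursion) (heps : D.epsSpec)
    {c' : ℤ} (hLl : D.scriptL l = 2 * c') {α : APoint D.H} {u : ℤ}
    (h35m : IsOfFinAddOrder ((2 : ℤ) • D.P (2 * q) - (u * D.scriptL (2 * q)) • α)) :
    ∃ s : ℤ, (s = 1 ∨ s = -1) ∧
      IsOfFinAddOrder (D.P n - (D.Z n - (s * c' * (u * D.scriptL (2 * q))) • α)) := by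
  obtain ⟨hPm, s, hs, hP⟩ := P_eq_of_typeE1 hl hq hl8 hq3 hn D hrec heps
  exact ⟨s, hs, genusPoint_congr_of_one_block D hPm hP hLl h35m⟩

/-- **Type E1: C⁺ at `2lq` ⟺ `depth(Z(2lq) − c·α_{2q}) = depth(Q₁)` in `A(ℍ′)/tors`** (g3's criterion with §2; same side data as
`LevelTwoTwoPrimes.levelTwo_two_primes_iff`). [cite: TianYuanZhang2017, Thm. 3.5 (p0011 L94–L100), §3.1] [cite: Darmon2004, Thm. 3.22] -/
theorem levelTwo_typeE1_iff {l q : ℕ} (hl : l.Prime) (hq : q.Prime) (hl8 : l % 8 = 1) (hq3 : q % 8 = 3)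
    (hn : n = 2 * (l * q)) (hGZK : rank_eq_analyticRank_of_analyticRank_le_one) (hsq : Squarefree n)
    (hr : (congruentNumberCurve n).analyticRank = 1)
    (D : GenusPointData n) (h35 : D.thm35Main) (hLs : D.scriptLSpec) (hrec : D.recursion) (heps : D.epsSpec)
    {c' : ℤ} (hLl : D.scriptL l = 2 * c') {α : APoint D.H} {u : ℤ}
    (h35m : IsOfFinAddOrder ((2 : ℤ) • D.P (2 * q) - (u * D.scriptL (2 * q)) • α))
    {R : (congruentNumberCurve n).toAffine.Point} (hR : ∀ x, ∃ k : ℤ, IsOfFinAddOrder (x - k • R))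
    {Q₁ : APoint D.H} (hQ₁ : φH D Q₁ = Point.map (W' := curveA.twoIsogenyCodomain)
      (D.embK n (Nat.mem_divisors_self n hsq.ne_zero)) (ΘE hsq.ne_zero R)) :
    ∃ s : ℤ, (s = 1 ∨ s = -1) ∧
      ((∀ L : ℤ, IsScriptL n L → (2 : ℤ) ∣ L ∧ ¬ (4 : ℤ) ∣ L) ↔
        ∀ k : ℕ, ((∃ y : APoint D.H, IsOfFinAddOrder (D.Z n - (s * c' * (u * D.scriptL (2 * q))) • α - ((2 : ℤ) ^ k) • y)) ↔
          ∃ y : APoint D.H, IsOfFinAddOrder (Q₁ - ((2 : ℤ) ^ k) • y))) := by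
  have h8 : n % 8 = 5 ∨ n % 8 = 6 ∨ n % 8 = 7 :=
    Or.inr (Or.inl (by rw [hn, Nat.mul_mod, mul_mod_eight_of_one hl8, hq3]))
  obtain ⟨s, hs, h⟩ := genusPoint_typeE1_congr hl hq hl8 hq3 hn D hrec heps hLl h35m
  refine ⟨s, hs, ?_⟩
  rw [levelTwo_iff_twoPowDivisible_iff_half hGZK hsq h8 hr D h35 hLs hR hQ₁]
  exact forall_congr' fun k => by rw [twoPowDivisible_iff_of_sub_isOfFinAddOrder h k]

/- Layer 1 for type E1: apply `LevelTwoTwoPrimes.twoDivisible_iff_of_even` / `…_of_odd` to `genusPoint_typeE1_congr` — `[P(2lq)] = [Z(2lq)]`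
when `c′·u·𝓛(2q)` is even (in particular when `4 ∣ 𝓛(l)`, or when `ρ(2q) = 1`), `[P(2lq)] = [Z(2lq) − α_{2q}]` when it is odd. -/

end TypeE1

/-! ## §3 Type E2: `n = 2lq`, `l ≡ 1`, `q ≡ 7 (mod 8)` — three lower blocks `q`, `2q`, `lq`; the odd member `lq` sits inside -/

section TypeE2

/-- `recursionIndex (2q) = {q}` for a prime `q ≡ 7 (mod 8)` (`d₀ = q ≡ 7`, cofactor `2`). [cite: TianYuanZhang2017, §3.1 (p0011 L67–L70)] -/
theorem recursionIndex_two_mul_seven {q : ℕ} (hq : q.Prime) (hq7 : q % 8 = 7) : recursionIndex (2 * q) = {q} := by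
  have e2 : 2 * q / q = 2 := Nat.mul_div_cancel 2 hq.pos
  ext d₀
  simp only [recursionIndex, Finset.mem_filter, Nat.mem_divisors, Finset.mem_singleton]
  constructor
  · rintro ⟨⟨hd, -⟩, h567, h123, hgt⟩
    rcases (ThetaDescent.dvd_prime_mul_prime_iff Nat.prime_two hq).mp hd with rfl | rfl | rfl | rfl
    · omega
    · omega
    · rfl
    · rw [Nat.div_self (by omega)] at hgt; omega
  · rintro rfl
    refine ⟨⟨Dvd.intro_left 2 rfl, by omega⟩, by omega, ?_, ?_⟩
    · rw [e2]; omega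
    · rw [e2]; omega

/-- **`recursionIndex (2lq) = {q, 2q, lq}`** for primes `l ≡ 1`, `q ≡ 7 (mod 8)`: `q ≡ 7` (cofactor `2l ≡ 2`), `2q ≡ 6` (cofactor `l ≡ 1`),
`lq ≡ 7` (cofactor `2`). [cite: TianYuanZhang2017, §3.1 (p0011 L67–L70)] -/
theorem recursionIndex_typeE2 {l q : ℕ} (hl : l.Prime) (hq : q.Prime) (hl8 : l % 8 = 1) (hq7 : q % 8 = 7) :
    recursionIndex (2 * (l * q)) = {q, 2 * q, l * q} := by
  have hl2 : l ≠ 2 := by omega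
  have hq2 : q ≠ 2 := by omega
  have hN0 : 2 * (l * q) ≠ 0 := Nat.mul_ne_zero two_ne_zero (Nat.mul_ne_zero hl.ne_zero hq.ne_zero)
  have el : 2 * (l * q) / l = 2 * q := by
    rw [show 2 * (l * q) = l * (2 * q) by ring]; exact Nat.mul_div_cancel_left (2 * q) hl.pos
  have eq' : 2 * (l * q) / q = 2 * l := by
    rw [show 2 * (l * q) = q * (2 * l) by ring]; exact Nat.mul_div_cancel_left (2 * l) hq.pos
  have e2l : 2 * (l * q) / (2 * l) = q := by
    rw [show 2 * (l * q) = (2 * l) * q by ring]; exact Nat.mul_div_cancel_left q (by omega)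
  have e2q : 2 * (l * q) / (2 * q) = l := by
    rw [show 2 * (l * q) = (2 * q) * l by ring]; exact Nat.mul_div_cancel_left l (by omega)
  have elq : 2 * (l * q) / (l * q) = 2 := Nat.mul_div_cancel 2 (Nat.mul_pos hl.pos hq.pos)
  have eN : 2 * (l * q) / (2 * (l * q)) = 1 := Nat.div_self (Nat.pos_of_ne_zero hN0)
  have e2 : 2 * (l * q) / 2 = l * q := Nat.mul_div_cancel_left (l * q) two_pos
  have hlq8 : (l * q) % 8 = 7 := by rw [mul_mod_eight_of_one hl8, hq7]
  have h2l8 : (2 * l) % 8 = 2 := by rw [Nat.mul_mod, hl8]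
  have h2q8 : (2 * q) % 8 = 6 := by rw [Nat.mul_mod, hq7]
  ext d₀
  simp only [recursionIndex, Finset.mem_filter, Nat.mem_divisors, Finset.mem_insert, Finset.mem_singleton]
  constructor
  · rintro ⟨⟨hd, -⟩, h567, h123, hgt⟩
    have hd' : d₀ ∣ 2 * l * q := by rwa [mul_assoc]
    rcases (dvd_mul_three_iff Nat.prime_two hl hq).mp hd' with rfl | rfl | rfl | rfl | rfl | rfl | rfl | rfl
    · omega
    · omega
    · omega
    · exact Or.inl rfl
    · omega
    · exact Or.inr (Or.inl rfl)
    · exact Or.inr (Or.inr rfl)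
    · rw [show 2 * l * q = 2 * (l * q) by ring, eN] at hgt; omega
  · rintro (rfl | rfl | rfl)
    · refine ⟨⟨Dvd.intro_left (2 * l) (by ring), hN0⟩, by omega, ?_, ?_⟩
      · rw [eq']; omega
      · rw [eq']; omega
    · refine ⟨⟨Dvd.intro_left l (by ring), hN0⟩, by omega, ?_, ?_⟩
      · rw [e2q]; omega
      · rw [e2q]; exact hl.one_lt
    · refine ⟨⟨Dvd.intro_left 2 rfl, hN0⟩, by omega, ?_, ?_⟩
      · rw [elq]; omega
      · rw [elq]; omega

/-- **Type E2 recursion, EXACT in `A(ℍ′_{2lq})`**: with signs `s₁, s₂, s₃ = ±1` (all three `ε`-types `(7,2)`, `(6,1)`, `(7,2)` are `≠ (5,3)`),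
`P(2lq) = Z(2lq) − s₁·𝓛(2l)·P(q) − s₂·𝓛(l)·P(2q) − s₃·𝓛(2)·P(lq)`, and `P(q) = Z(q)`.
[cite: TianYuanZhang2017, §3.1 (p0011 L67–L73), Thm. 3.3 (p0011 L49–L51)] -/
theorem P_eq_of_typeE2 {l q : ℕ} (hl : l.Prime) (hq : q.Prime) (hl8 : l % 8 = 1) (hq7 : q % 8 = 7)
    (hn : n = 2 * (l * q)) (D : GenusPointData n) (hrec : D.recursion) (heps : D.epsSpec) :
    D.P q = D.Z q ∧ ∃ s₁ s₂ s₃ : ℤ, (s₁ = 1 ∨ s₁ = -1) ∧ (s₂ = 1 ∨ s₂ = -1) ∧ (s₃ = 1 ∨ s₃ = -1) ∧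
      D.P n = D.Z n - s₁ • (D.scriptL (2 * l) • D.P q) - s₂ • (D.scriptL l • D.P (2 * q)) - s₃ • (D.scriptL 2 • D.P (l * q)) := by
  subst hn
  have hl2 : l ≠ 2 := by omega
  have hq2 : q ≠ 2 := by omega
  have hN0 : 2 * (l * q) ≠ 0 := Nat.mul_ne_zero two_ne_zero (Nat.mul_ne_zero hl.ne_zero hq.ne_zero)
  have eq' : 2 * (l * q) / q = 2 * l := by
    rw [show 2 * (l * q) = q * (2 * l) by ring]; exact Nat.mul_div_cancel_left (2 * l) hq.pos
  have e2q : 2 * (l * q) / (2 * q) = l := by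
    rw [show 2 * (l * q) = (2 * q) * l by ring]; exact Nat.mul_div_cancel_left l (by omega)
  have elq : 2 * (l * q) / (l * q) = 2 := Nat.mul_div_cancel 2 (Nat.mul_pos hl.pos hq.pos)
  have hlq8 : (l * q) % 8 = 7 := by rw [mul_mod_eight_of_one hl8, hq7]
  have h2q8 : (2 * q) % 8 = 6 := by rw [Nat.mul_mod, hq7]
  -- `P(q) = Z(q)`
  have hPq : D.P q = D.Z q := by
    have h := hrec q (Nat.mem_divisors.mpr ⟨Dvd.intro_left (2 * l) (by ring), hN0⟩) (Or.inr (Or.inr hq7))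
    rw [ThetaDescent.recursionIndex_prime hq, Finset.sum_empty, sub_zero] at h
    exact h
  refine ⟨hPq, ?_⟩
  -- the three `ε` exponents are even
  have hev : ∀ d₀ d₁ : ℕ, ¬ (d₀ % 8 = 5 ∧ d₁ % 8 = 3) → Even (D.eps d₀ d₁) := by
    intro d₀ d₁ hno
    rw [Nat.even_iff]
    by_contra hodd
    exact hno ((heps d₀ d₁).mp (by omega))
  obtain ⟨s₁, hs₁, h₁⟩ := cmIPow_even_eq_sign_smul D (hev q (2 * l) (by omega))
  obtain ⟨s₂, hs₂, h₂⟩ := cmIPow_even_eq_sign_smul D (hev (2 * q) l (by omega))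
  obtain ⟨s₃, hs₃, h₃⟩ := cmIPow_even_eq_sign_smul D (hev (l * q) 2 (by omega))
  have hn8 : (2 * (l * q)) % 8 = 6 := by rw [Nat.mul_mod, hlq8]
  have hP := hrec (2 * (l * q)) (Nat.mem_divisors_self _ hN0) (Or.inr (Or.inl hn8))
  have hq2q : q ≠ 2 * q := by omega
  have hqlq : q ≠ l * q := by
    intro h; have : l * q = 1 * q := by omega
    exact hl.one_lt.ne' (Nat.eq_of_mul_eq_mul_right hq.pos this)
  have h2qlq : 2 * q ≠ l * q := fun h => hl2 (Nat.eq_of_mul_eq_mul_right hq.pos h).symm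
  rw [recursionIndex_typeE2 hl hq hl8 hq7, Finset.sum_insert (by simp [hq2q, hqlq]),
    Finset.sum_insert (by simpa using h2qlq), Finset.sum_singleton, eq', e2q, elq, h₁, h₂, h₃] at hP
  refine ⟨s₁, s₂, s₃, hs₁, hs₂, hs₃, ?_⟩
  rw [hP]
  abel

/-- **Type E2: `P(2lq) ≡ Z(2lq) − s₃𝓛(2)·P(lq) − c_q·α_q − c_{2q}·α_{2q}` modulo torsion**, `c_q = s₁·a′·u_q·𝓛(q)`, `c_{2q} = s₂·c′·u_{2q}·𝓛(2q)`,
from `𝓛(2l) = 2a′`, `𝓛(l) = 2c′` (Thm 1.1 at `2l`, `l`: `g(2l)`, `g(l)` even) and Thm 3.5 at `q` and at `2q` read in `ℍ′_{2lq}` — the ODD two-prime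
member `lq` (type R2) survives with the odd coefficient `𝓛(2)` (Thm 1.1 at `2`) and is NOT halved.
[cite: TianYuanZhang2017, §3.1 (p0011 L67–L73), Thm. 3.5 (p0011 L94–L100), Thm. 1.1 (p0002 L90–L99)] -/
theorem genusPoint_typeE2_congr {l q : ℕ} (hl : l.Prime) (hq : q.Prime) (hl8 : l % 8 = 1) (hq7 : q % 8 = 7)
    (hn : n = 2 * (l * q)) (D : GenusPointData n) (hrec : D.recursion) (heps : D.epsSpec)
    {a' c' : ℤ} (hL2l : D.scriptL (2 * l) = 2 * a') (hLl : D.scriptL l = 2 * c')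
    {αq α2q : APoint D.H} {uq u2q : ℤ}
    (h35q : IsOfFinAddOrder ((2 : ℤ) • D.P q - (uq * D.scriptL q) • αq))
    (h352q : IsOfFinAddOrder ((2 : ℤ) • D.P (2 * q) - (u2q * D.scriptL (2 * q)) • α2q)) :
    ∃ s₃ s₁ s₂ : ℤ, (s₃ = 1 ∨ s₃ = -1) ∧ (s₁ = 1 ∨ s₁ = -1) ∧ (s₂ = 1 ∨ s₂ = -1) ∧
      IsOfFinAddOrder (D.P n - (D.Z n - s₃ • (D.scriptL 2 • D.P (l * q))
        - (s₁ * a' * (uq * D.scriptL q)) • αq - (s₂ * c' * (u2q * D.scriptL (2 * q))) • α2q)) := by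
  obtain ⟨-, s₁, s₂, s₃, hs₁, hs₂, hs₃, hP⟩ := P_eq_of_typeE2 hl hq hl8 hq7 hn D hrec heps
  refine ⟨s₃, s₁, s₂, hs₃, hs₁, hs₂, ?_⟩
  have e : D.P n - (D.Z n - s₃ • (D.scriptL 2 • D.P (l * q))
        - (s₁ * a' * (uq * D.scriptL q)) • αq - (s₂ * c' * (u2q * D.scriptL (2 * q))) • α2q) =
      (-(s₁ * a')) • ((2 : ℤ) • D.P q - (uq * D.scriptL q) • αq) +
        (-(s₂ * c')) • ((2 : ℤ) • D.P (2 * q) - (u2q * D.scriptL (2 * q)) • α2q) := by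
    rw [hP, hL2l, hLl]
    module
  rw [e]
  exact (h35q.zsmul).add h352q.zsmul

/-- **Type E2 through the odd member's closed form**: combining with `LevelTwoTwoPrimes.genusPoint_two_primes_congr` for `lq` read in `ℍ′_{2lq}`
— here as the hypothesis `hlq : P(lq) − (Z(lq) − c·α_q)` torsion (the odd sector's conclusion, with the SAME `α_q`) — and `𝓛(2) = ±1`
(`hL2`; `𝓛(2)² = #Ш_an(E_2) = 1`, the rank-zero value at `n = 2`, carried as a hypothesis):
**`P(2lq) ≡ Z(2lq) − t·Z(lq) − c₁·α_q − c_{2q}·α_{2q}` modulo torsion** with `t = ±1` and `c₁ = s₁a′u_q𝓛(q) − t·c`.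
[cite: TianYuanZhang2017, §3.1 (p0011 L67–L73), Thm. 3.5 (p0011 L94–L100), Thm. 1.1] -/
theorem genusPoint_typeE2_congr_genusPeriods {l q : ℕ} (hl : l.Prime) (hq : q.Prime) (hl8 : l % 8 = 1) (hq7 : q % 8 = 7)
    (hn : n = 2 * (l * q)) (D : GenusPointData n) (hrec : D.recursion) (heps : D.epsSpec)
    {a' c' : ℤ} (hL2l : D.scriptL (2 * l) = 2 * a') (hLl : D.scriptL l = 2 * c') (hL2 : D.scriptL 2 = 1 ∨ D.scriptL 2 = -1)
    {αq α2q : APoint D.H} {uq u2q c : ℤ}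
    (h35q : IsOfFinAddOrder ((2 : ℤ) • D.P q - (uq * D.scriptL q) • αq))
    (h352q : IsOfFinAddOrder ((2 : ℤ) • D.P (2 * q) - (u2q * D.scriptL (2 * q)) • α2q))
    (hlq : IsOfFinAddOrder (D.P (l * q) - (D.Z (l * q) - c • αq))) :
    ∃ t s₁ s₂ : ℤ, (t = 1 ∨ t = -1) ∧ (s₁ = 1 ∨ s₁ = -1) ∧ (s₂ = 1 ∨ s₂ = -1) ∧
      IsOfFinAddOrder (D.P n - (D.Z n - t • D.Z (l * q)
        - (s₁ * a' * (uq * D.scriptL q) - t * c) • αq - (s₂ * c' * (u2q * D.scriptL (2 * q))) • α2q)) := by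
  obtain ⟨s₃, s₁, s₂, hs₃, hs₁, hs₂, h⟩ := genusPoint_typeE2_congr hl hq hl8 hq7 hn D hrec heps hL2l hLl h35q h352q
  refine ⟨s₃ * D.scriptL 2, s₁, s₂, ?_, hs₁, hs₂, ?_⟩
  · rcases hs₃ with rfl | rfl <;> rcases hL2 with h2 | h2 <;> simp [h2]
  have e : D.P n - (D.Z n - (s₃ * D.scriptL 2) • D.Z (l * q)
        - (s₁ * a' * (uq * D.scriptL q) - s₃ * D.scriptL 2 * c) • αq - (s₂ * c' * (u2q * D.scriptL (2 * q))) • α2q) =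
      (D.P n - (D.Z n - s₃ • (D.scriptL 2 • D.P (l * q))
        - (s₁ * a' * (uq * D.scriptL q)) • αq - (s₂ * c' * (u2q * D.scriptL (2 * q))) • α2q))
      + (-(s₃ * D.scriptL 2)) • (D.P (l * q) - (D.Z (l * q) - c • αq)) := by
    module
  rw [e]
  exact h.add hlq.zsmul

/-- **Type E2: equal depth of `P(2lq)` and `Z(2lq) − t·Z(lq) − c₁·α_q − c_{2q}·α_{2q}`** (every `k`), hence — with g3's
`levelTwo_iff_twoPowDivisible_iff_half` exactly as in `levelTwo_typeE1_iff` — C⁺ at `2lq` is the comparison of THAT point's depth with `depth(Q₁)`.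
[cite: TianYuanZhang2017, §3.1 (p0011 L67–L73), Thm. 3.5 (p0011 L94–L100)] -/
theorem twoPowDivisible_genusPoint_typeE2_iff {l q : ℕ} (hl : l.Prime) (hq : q.Prime) (hl8 : l % 8 = 1) (hq7 : q % 8 = 7)
    (hn : n = 2 * (l * q)) (D : GenusPointData n) (hrec : D.recursion) (heps : D.epsSpec)
    {a' c' : ℤ} (hL2l : D.scriptL (2 * l) = 2 * a') (hLl : D.scriptL l = 2 * c') (hL2 : D.scriptL 2 = 1 ∨ D.scriptL 2 = -1)
    {αq α2q : APoint D.H} {uq u2q c : ℤ}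
    (h35q : IsOfFinAddOrder ((2 : ℤ) • D.P q - (uq * D.scriptL q) • αq))
    (h352q : IsOfFinAddOrder ((2 : ℤ) • D.P (2 * q) - (u2q * D.scriptL (2 * q)) • α2q))
    (hlq : IsOfFinAddOrder (D.P (l * q) - (D.Z (l * q) - c • αq))) :
    ∃ t s₁ s₂ : ℤ, (t = 1 ∨ t = -1) ∧ (s₁ = 1 ∨ s₁ = -1) ∧ (s₂ = 1 ∨ s₂ = -1) ∧ ∀ k : ℕ,
      ((∃ y : APoint D.H, IsOfFinAddOrder (D.P n - ((2 : ℤ) ^ k) • y)) ↔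
        ∃ y : APoint D.H, IsOfFinAddOrder (D.Z n - t • D.Z (l * q)
          - (s₁ * a' * (uq * D.scriptL q) - t * c) • αq - (s₂ * c' * (u2q * D.scriptL (2 * q))) • α2q - ((2 : ℤ) ^ k) • y)) := by
  obtain ⟨t, s₁, s₂, ht, hs₁, hs₂, h⟩ :=
    genusPoint_typeE2_congr_genusPeriods hl hq hl8 hq7 hn D hrec heps hL2l hLl hL2 h35q h352q hlq
  exact ⟨t, s₁, s₂, ht, hs₁, hs₂, fun k => twoPowDivisible_iff_of_sub_isOfFinAddOrder h k⟩

/-- **Type E2: C⁺ at `2lq` as ONE depth comparison** (data as in `levelTwo_typeE1_iff`, plus Thm 3.5 at `q`, `2q`, the odd member's closed form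
`hlq`, `𝓛(2l) = 2a′`, `𝓛(l) = 2c′`, `𝓛(2) = ±1`): `2 ∥ 𝓛(2lq)` iff for every `k`,
`Z(2lq) − t·Z(lq) − c₁·α_q − c_{2q}·α_{2q} ∈ 2^k A(ℍ′) + tors ⟺ Q₁ ∈ 2^k A(ℍ′) + tors`.
[cite: TianYuanZhang2017, Thm. 3.5 (p0011 L94–L100), §3.1 (p0011 L67–L73)] [cite: Darmon2004, Thm. 3.22] -/
theorem levelTwo_typeE2_iff {l q : ℕ} (hl : l.Prime) (hq : q.Prime) (hl8 : l % 8 = 1) (hq7 : q % 8 = 7)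
    (hn : n = 2 * (l * q)) (hGZK : rank_eq_analyticRank_of_analyticRank_le_one) (hsq : Squarefree n)
    (hr : (congruentNumberCurve n).analyticRank = 1)
    (D : GenusPointData n) (h35 : D.thm35Main) (hLs : D.scriptLSpec) (hrec : D.recursion) (heps : D.epsSpec)
    {a' c' : ℤ} (hL2l : D.scriptL (2 * l) = 2 * a') (hLl : D.scriptL l = 2 * c') (hL2 : D.scriptL 2 = 1 ∨ D.scriptL 2 = -1)
    {αq α2q : APoint D.H} {uq u2q c : ℤ}
    (h35q : IsOfFinAddOrder ((2 : ℤ) • D.P q - (uq * D.scriptL q) • αq))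
    (h352q : IsOfFinAddOrder ((2 : ℤ) • D.P (2 * q) - (u2q * D.scriptL (2 * q)) • α2q))
    (hlq : IsOfFinAddOrder (D.P (l * q) - (D.Z (l * q) - c • αq)))
    {R : (congruentNumberCurve n).toAffine.Point} (hR : ∀ x, ∃ k : ℤ, IsOfFinAddOrder (x - k • R))
    {Q₁ : APoint D.H} (hQ₁ : φH D Q₁ = Point.map (W' := curveA.twoIsogenyCodomain)
      (D.embK n (Nat.mem_divisors_self n hsq.ne_zero)) (ΘE hsq.ne_zero R)) :
    ∃ t s₁ s₂ : ℤ, (t = 1 ∨ t = -1) ∧ (s₁ = 1 ∨ s₁ = -1) ∧ (s₂ = 1 ∨ s₂ = -1) ∧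
      ((∀ L : ℤ, IsScriptL n L → (2 : ℤ) ∣ L ∧ ¬ (4 : ℤ) ∣ L) ↔
        ∀ k : ℕ, ((∃ y : APoint D.H, IsOfFinAddOrder (D.Z n - t • D.Z (l * q)
            - (s₁ * a' * (uq * D.scriptL q) - t * c) • αq - (s₂ * c' * (u2q * D.scriptL (2 * q))) • α2q - ((2 : ℤ) ^ k) • y)) ↔
          ∃ y : APoint D.H, IsOfFinAddOrder (Q₁ - ((2 : ℤ) ^ k) • y))) := by
  have h8 : n % 8 = 5 ∨ n % 8 = 6 ∨ n % 8 = 7 :=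
    Or.inr (Or.inl (by rw [hn, Nat.mul_mod, mul_mod_eight_of_one hl8, hq7]))
  obtain ⟨t, s₁, s₂, ht, hs₁, hs₂, h⟩ :=
    twoPowDivisible_genusPoint_typeE2_iff hl hq hl8 hq7 hn D hrec heps hL2l hLl hL2 h35q h352q hlq
  refine ⟨t, s₁, s₂, ht, hs₁, hs₂, ?_⟩
  rw [levelTwo_iff_twoPowDivisible_iff_half hGZK hsq h8 hr D h35 hLs hR hQ₁]
  exact forall_congr' fun k => by rw [h k]

end TypeE2

end Summit.BirchSwinnertonDyer.PrintCf2.LevelTwoTwoPrimesEven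

end
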